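import Mathlib
import HarnessLib
import Literature.MathematicalPhysics.QuantumFieldTheory.LatticeSiteRPMechanism

/-!
# Vanishing of the Gram expansion: every word vanishes when the exponential form does

Helper for the crux `FemtoCurvatureTwoPoint` (stmt-QuantumFields-9363, route `LangevinControlUV`),
registered sub-goal `stub_axisPositive` (strict positivity of the axis covariance on ODD tori).
Complex companion of the tree's `LatticeRP.integral_mul_mul_exp_sum_nonneg` (positivity by Gram
expansion): if `∫ (u ∏ₜ a_{wₜ}) (v ∏ₜ b_{wₜ}) dν ≥ 0` for every finite word `w` AND
`∫ u v exp(∑ᵢ aᵢ bᵢ) dν = 0`, then every word integral vanishes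
(`integral_word_eq_zero_of_integral_mul_mul_exp_sum_eq_zero`), in particular the empty word:
`∫ u v dν = 0`. Applied to the abstract reflection-positivity mechanism with a shared block
(`LatticeRP.integral_mul_conj_mul_exp_nonneg_of_shared`): if the reflection form of the Wilson weight
vanishes, so does its crossing-free part (`integral_splice_mul_conj_comp_eq_zero_of_exp_eq_zero`).
-/

set_option autoImplicit false

noncomputable section

open MeasureTheory Finset
open scoped ComplexOrder ComplexConjugate

namespace Summit.QuantumFields.YangMills.Theorems.FemtoCurvatureTwoPoint.GramZero

section Gram

variable {X : Type*} [MeasurableSpace X] (ν : Measure X) [IsFiniteMeasure ν]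
variable {I : Type*} [Fintype I]

/-- A series in `ℂ` with non-negative terms and sum `0` has all terms `0`. [folklore] -/
theorem eq_zero_of_hasSum_zero_of_nonneg {f : ℕ → ℂ} (hf : ∀ n, 0 ≤ f n) (h : HasSum f 0) (n : ℕ) :
    f n = 0 := by
  rw [Complex.hasSum_iff] at h
  have hre : HasSum (fun k => (f k).re) 0 := by simpa using h.1
  have hle : (f n).re ≤ 0 := le_hasSum hre n fun k _ => (Complex.nonneg_iff.1 (hf k)).1
  have hge : 0 ≤ (f n).re := (Complex.nonneg_iff.1 (hf n)).1
  have him : (f n).im = 0 := ((Complex.nonneg_iff.1 (hf n)).2).symm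
  exact Complex.ext (by simp; linarith) (by simp [him])

/-- A finite sum in `ℂ` of non-negative terms vanishes only if every term does. [folklore] -/
theorem eq_zero_of_sum_eq_zero_of_nonneg {κ : Type*} (s : Finset κ) {f : κ → ℂ}
    (hf : ∀ k ∈ s, 0 ≤ f k) (h : ∑ k ∈ s, f k = 0) : ∀ k ∈ s, f k = 0 := by
  have hre : ∑ k ∈ s, (f k).re = 0 := by
    have := congrArg Complex.re h
    simpa [Complex.re_sum] using this
  have hre0 := (Finset.sum_eq_zero_iff_of_nonneg fun k hk => (Complex.nonneg_iff.1 (hf k hk)).1).1 hre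
  intro k hk
  exact Complex.ext (by simpa using hre0 k hk) (by simpa using ((Complex.nonneg_iff.1 (hf k hk)).2).symm)

omit [MeasurableSpace X] in
/-- Norm of a product of `n` functions each bounded by `Ka` in norm. [folklore] -/
private theorem norm_prod_le_abs_pow {n : ℕ} {c : Fin n → X → ℂ} {Ka : ℝ}
    (hc : ∀ t x, ‖c t x‖ ≤ Ka) (x : X) : ‖∏ t, c t x‖ ≤ |Ka| ^ n := by
  calc ‖∏ t, c t x‖ = ∏ t, ‖c t x‖ := norm_prod _ _
    _ ≤ ∏ _t : Fin n, |Ka| :=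
        Finset.prod_le_prod (fun _ _ => norm_nonneg _) fun t _ => (hc t x).trans (le_abs_self _)
    _ = |Ka| ^ n := by simp

/-- **Vanishing by Gram expansion.** Let `u, v, aᵢ, bᵢ` be bounded measurable complex functions on a
finite measure space with `∫ (u ∏ₜ a_{wₜ}) (v ∏ₜ b_{wₜ}) dν ≥ 0` for every finite word `w`. If
`∫ u v exp(∑ᵢ aᵢ bᵢ) dν = 0`, then every word integral vanishes. [folklore] -/
theorem integral_word_eq_zero_of_integral_mul_mul_exp_sum_eq_zero (u v : X → ℂ) (a b : I → X → ℂ)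
    (hu : Measurable u) (hv : Measurable v) (ha : ∀ i, Measurable (a i))
    (hb : ∀ i, Measurable (b i)) {Ku Ka : ℝ} (hub : ∀ x, ‖u x‖ ≤ Ku) (hvb : ∀ x, ‖v x‖ ≤ Ku)
    (hab : ∀ i x, ‖a i x‖ ≤ Ka) (hbb : ∀ i x, ‖b i x‖ ≤ Ka)
    (hpos : ∀ (n : ℕ) (w : Fin n → I),
      0 ≤ ∫ x, (u x * ∏ t, a (w t) x) * (v x * ∏ t, b (w t) x) ∂ν)
    (h0 : ∫ x, u x * v x * Complex.exp (∑ i, a i x * b i x) ∂ν = 0)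
    (n : ℕ) (w : Fin n → I) :
    ∫ x, (u x * ∏ t, a (w t) x) * (v x * ∏ t, b (w t) x) ∂ν = 0 := by
  classical
  set s : X → ℂ := fun x => ∑ i, a i x * b i x with hs_def
  have hsm : Measurable s := Finset.measurable_sum _ fun i _ => (ha i).mul (hb i)
  set B : ℝ := (Fintype.card I : ℝ) * (Ka * Ka) with hB_def
  have hsB : ∀ x, ‖s x‖ ≤ B := fun x => by
    calc ‖s x‖ ≤ ∑ i, ‖a i x * b i x‖ := norm_sum_le _ _
      _ ≤ ∑ _i : I, Ka * Ka := Finset.sum_le_sum fun i _ => by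
          rw [norm_mul]
          exact mul_le_mul (hab i x) (hbb i x) (norm_nonneg _) ((norm_nonneg _).trans (hab i x))
      _ = B := by rw [Finset.sum_const, Finset.card_univ, nsmul_eq_mul]
  -- the terms of the exponential series
  set T : ℕ → X → ℂ := fun k x => u x * v x * (s x ^ k / (k.factorial : ℂ)) with hT_def
  have hTm : ∀ k, Measurable (T k) := fun k =>
    (hu.mul hv).mul ((hsm.pow_const k).div_const _)
  have hlim : ∀ x, HasSum (fun k => T k x) (u x * v x * Complex.exp (s x)) := fun x => by
    have h := NormedSpace.expSeries_div_hasSum_exp (s x)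
    rw [← congr_fun Complex.exp_eq_exp_ℂ (s x)] at h
    exact h.mul_left (u x * v x)
  set bound : ℕ → X → ℝ := fun k _ => Ku * Ku * (B ^ k / (k.factorial : ℝ)) with hbound_def
  have hTb : ∀ k x, ‖T k x‖ ≤ bound k x := fun k x => by
    simp only [hT_def, hbound_def, norm_mul, norm_div, norm_pow, Complex.norm_natCast]
    have h1 : ‖u x‖ * ‖v x‖ ≤ Ku * Ku :=
      mul_le_mul (hub x) (hvb x) (norm_nonneg _) ((norm_nonneg _).trans (hub x))
    have h2 : ‖s x‖ ^ k / (k.factorial : ℝ) ≤ B ^ k / (k.factorial : ℝ) :=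
      div_le_div_of_nonneg_right (pow_le_pow_left₀ (norm_nonneg _) (hsB x) k) (Nat.cast_nonneg _)
    exact mul_le_mul h1 h2 (by positivity) (mul_nonneg ((norm_nonneg _).trans (hub x))
      ((norm_nonneg _).trans (hub x)))
  have hsum : HasSum (fun k => ∫ x, T k x ∂ν) (∫ x, u x * v x * Complex.exp (s x) ∂ν) := by
    refine hasSum_integral_of_dominated_convergence bound
      (fun k => (hTm k).aestronglyMeasurable) (fun k => ae_of_all _ (hTb k))
      (ae_of_all _ fun x => ?_) ?_ (ae_of_all _ hlim)
    · exact (Real.summable_pow_div_factorial B).mul_left (Ku * Ku)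
    · show Integrable (fun _ => ∑' k : ℕ, Ku * Ku * (B ^ k / ((k.factorial : ℕ) : ℝ))) ν
      exact integrable_const _
  -- each term is `(k!)⁻¹ ∑_words (word integral)`
  have hint : ∀ (k : ℕ) (w' : Fin k → I),
      Integrable (fun x => (u x * ∏ t, a (w' t) x) * (v x * ∏ t, b (w' t) x)) ν := fun k w' => by
    refine Integrable.of_bound (((hu.mul (Finset.measurable_prod _ fun t _ => ha (w' t))).mul
        (hv.mul (Finset.measurable_prod _ fun t _ => hb (w' t)))).aestronglyMeasurable)
      ((|Ku| * |Ka| ^ k) * (|Ku| * |Ka| ^ k)) (ae_of_all _ fun x => ?_)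
    rw [norm_mul, norm_mul, norm_mul]
    have hua : ‖u x‖ * ‖∏ t, a (w' t) x‖ ≤ |Ku| * |Ka| ^ k :=
      mul_le_mul ((hub x).trans (le_abs_self _)) (norm_prod_le_abs_pow (fun t => hab (w' t)) x)
        (norm_nonneg _) (abs_nonneg _)
    have hvb' : ‖v x‖ * ‖∏ t, b (w' t) x‖ ≤ |Ku| * |Ka| ^ k :=
      mul_le_mul ((hvb x).trans (le_abs_self _)) (norm_prod_le_abs_pow (fun t => hbb (w' t)) x)
        (norm_nonneg _) (abs_nonneg _)
    exact mul_le_mul hua hvb' (by positivity) (by positivity)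
  have hTk : ∀ k, ∫ x, T k x ∂ν = ((k.factorial : ℝ)⁻¹ : ℝ) *
      ∑ w' : Fin k → I, ∫ x, (u x * ∏ t, a (w' t) x) * (v x * ∏ t, b (w' t) x) ∂ν := fun k => by
    have hTx : ∀ x, T k x = ((k.factorial : ℝ)⁻¹ : ℝ) *
        ∑ w' : Fin k → I, (u x * ∏ t, a (w' t) x) * (v x * ∏ t, b (w' t) x) := fun x => by
      have hpow : s x ^ k = ∑ w' : Fin k → I, (∏ t, a (w' t) x) * ∏ t, b (w' t) x := by
        simp only [hs_def, Fintype.sum_pow, Finset.prod_mul_distrib]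
      simp only [hT_def, hpow, div_eq_mul_inv, Finset.mul_sum, Finset.sum_mul, Complex.ofReal_inv,
        Complex.ofReal_natCast]
      exact Finset.sum_congr rfl fun w' _ => by ring
    simp_rw [hTx]
    rw [integral_const_mul, integral_finsetSum _ fun w' _ => hint k w']
  have hT0 : ∀ k, 0 ≤ ∫ x, T k x ∂ν := fun k => by
    rw [hTk]
    exact mul_nonneg (Complex.zero_le_real.2 (inv_nonneg.2 (Nat.cast_nonneg _)))
      (Finset.sum_nonneg fun w' _ => hpos k w')
  -- total `= 0` forces every term, hence every word, to vanish
  rw [h0] at hsum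
  have hTn0 : ∫ x, T n x ∂ν = 0 := eq_zero_of_hasSum_zero_of_nonneg hT0 hsum n
  rw [hTk] at hTn0
  have hfac : (((n.factorial : ℝ)⁻¹ : ℝ) : ℂ) ≠ 0 :=
    Complex.ofReal_ne_zero.2 (inv_ne_zero (Nat.cast_ne_zero.2 (Nat.factorial_ne_zero n)))
  have hsum0 := (mul_eq_zero.1 hTn0).resolve_left hfac
  exact eq_zero_of_sum_eq_zero_of_nonneg _ (fun w' _ => hpos n w') hsum0 w (Finset.mem_univ w)

end Gram

/-! ## The crossing-free part of a vanishing reflection form vanishes -/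

section Abstract

open Literature.MathematicalPhysics.QuantumFieldTheory.LatticeRP

variable {ι : Type*} [Fintype ι] [DecidableEq ι] {G : Type*} [MeasurableSpace G]
variable (μ₀ : Measure G) [IsProbabilityMeasure μ₀]
variable (M P C : Finset ι) (Θ : (ι → G) → (ι → G))

/-- **The empty Gram word of a vanishing reflection form vanishes.** In the setting of the tree's
abstract reflection positivity with a shared block
(`LatticeRP.integral_mul_conj_mul_exp_nonneg_of_shared`): if
`∫∫ g(z) conj g(ΘU) exp(∑ᵢ aᵢ(z) conj aᵢ(ΘU)) dμ(U) dμ(Y) = 0`, `z = splice C (U, Y)`, then the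
crossing-free reflection form `∫∫ g(z) conj g(ΘU) dμ(U) dμ(Y)` vanishes too. [folklore] -/
theorem integral_splice_mul_conj_comp_eq_zero_of_exp_eq_zero
    (hΘ : MeasurePreserving Θ (piMeasure μ₀) (piMeasure μ₀))
    (hΘM : ∀ U, ∀ i ∈ M, Θ U i = U i)
    (hΘdep : ∀ e ∈ P ∪ C, DependsOn (fun U => Θ U e) ((Pᶜ : Finset ι) : Set ι))
    (hMP : Disjoint M P) (hMC : Disjoint M C)
    {I : Type*} [Fintype I] {g : (ι → G) → ℂ} {a : I → (ι → G) → ℂ}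
    (hgm : Measurable g) (ham : ∀ i, Measurable (a i)) {Kg Ka : ℝ} (hgb : ∀ U, ‖g U‖ ≤ Kg)
    (hab : ∀ i U, ‖a i U‖ ≤ Ka) (hgdep : DependsOn g ((P ∪ C ∪ M : Finset ι) : Set ι))
    (hadep : ∀ i, DependsOn (a i) ((P ∪ C ∪ M : Finset ι) : Set ι))
    (h0 : ∫ p, g (splice C p) * conj (g (Θ p.1)) *
        Complex.exp (∑ i, a i (splice C p) * conj (a i (Θ p.1)))
      ∂((piMeasure μ₀).prod (piMeasure μ₀)) = 0) :
    ∫ p, g (splice C p) * conj (g (Θ p.1)) ∂((piMeasure μ₀).prod (piMeasure μ₀)) = 0 := by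
  have hΘm : Measurable Θ := hΘ.measurable
  have hconj : Measurable (starRingEnd ℂ : ℂ → ℂ) := Complex.continuous_conj.measurable
  have key := integral_word_eq_zero_of_integral_mul_mul_exp_sum_eq_zero _ (fun p => g (splice C p))
    (fun p => (starRingEnd ℂ) (g (Θ p.1))) (fun i p => a i (splice C p))
    (fun i p => (starRingEnd ℂ) (a i (Θ p.1)))
    (hgm.comp (measurable_splice C)) (hconj.comp (hgm.comp (hΘm.comp measurable_fst)))
    (fun i => (ham i).comp (measurable_splice C))
    (fun i => hconj.comp ((ham i).comp (hΘm.comp measurable_fst)))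
    (Ku := Kg) (Ka := Ka) (fun p => hgb _) (fun p => by rw [Complex.norm_conj]; exact hgb _)
    (fun i p => hab i _) (fun i p => by rw [Complex.norm_conj]; exact hab i _) (fun n w => ?_) h0 0
    Fin.elim0
  · simpa using key
  -- positivity of every word: the word `w` gives the observable `Φ = g ∏ₜ a_{wₜ}`
  set Φ : (ι → G) → ℂ := fun U => g U * ∏ t, a (w t) U with hΦ_def
  have hΦm : Measurable Φ := hgm.mul (Finset.measurable_prod _ fun t _ => ham (w t))
  have hΦb : ∀ U, ‖Φ U‖ ≤ |Kg| * |Ka| ^ n := fun U => by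
    rw [hΦ_def, norm_mul]
    refine mul_le_mul ((hgb U).trans (le_abs_self _)) ?_ (norm_nonneg _) (abs_nonneg _)
    calc ‖∏ t, a (w t) U‖ = ∏ t, ‖a (w t) U‖ := norm_prod _ _
      _ ≤ ∏ _t : Fin n, |Ka| :=
          Finset.prod_le_prod (fun _ _ => norm_nonneg _) fun t _ => (hab _ _).trans (le_abs_self _)
      _ = |Ka| ^ n := by simp
  have hΦdep : DependsOn Φ ((P ∪ C ∪ M : Finset ι) : Set ι) := fun U V hUV => by
    simp only [hΦ_def]
    rw [hgdep hUV]
    congr 1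
    exact Finset.prod_congr rfl fun t _ => hadep (w t) hUV
  have hk := integral_splice_mul_conj_comp_of_shared_nonneg μ₀ M P C Θ hΘ hΘM hΘdep hMP hMC
    hΦm hΦb hΦdep
  convert hk using 2
  funext p
  simp only [hΦ_def, map_mul, map_prod]

end Abstract

/-- **Registered sub-goal `stub_gramWordsZero`** (`--supports stmt-QuantumFields-9363`): closed form of
`integral_word_eq_zero_of_integral_mul_mul_exp_sum_eq_zero` — when the exponential Gram form vanishes and
all words are non-negative, every word vanishes. [folklore] -/
theorem stub_gramWordsZero : ∀ (X : Type) [MeasurableSpace X] (ν : MeasureTheory.Measure X) [MeasureTheory.IsFiniteMeasure ν] (I : Type) [Fintype I] (u v : X → ℂ) (a b : I → X → ℂ), Measurable u → Measurable v → (∀ i, Measurable (a i)) → (∀ i, Measurable (b i)) → ∀ (Ku Ka : ℝ), (∀ x, ‖u x‖ ≤ Ku) → (∀ x, ‖v x‖ ≤ Ku) → (∀ i x, ‖a i x‖ ≤ Ka) → (∀ i x, ‖b i x‖ ≤ Ka) → (∀ (n : ℕ) (w : Fin n → I), 0 ≤ ∫ x, (u x * ∏ t, a (w t) x) * (v x *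 ∏ t, b (w t) x) ∂ν) → (∫ x, u x * v x * Complex.exp (∑ i, a i x * b i x) ∂ν) = 0 → ∀ (n : ℕ) (w : Fin n → I), (∫ x, (u x * ∏ t, a (w t) x) * (v x * ∏ t, b (w t) x) ∂ν) = 0 := by
  intro X _ ν _ I _ u v a b hu hv ha hb Ku Ka hub hvb hab hbb hpos h0 n w
  exact integral_word_eq_zero_of_integral_mul_mul_exp_sum_eq_zero ν u v a b hu hv ha hb hub hvb hab hbb
    hpos h0 n w

end Summit.QuantumFields.YangMills.Theorems.FemtoCurvatureTwoPoint.GramZero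

end
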